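import Summits.Ventures.HodgeRepro2.T5HermitianDiagonalSign
import Summits.Ventures.HodgeRepro2.T5ShimuraOfHasseMinkowski

/-!
# Representation of an element of `K⁺` by a diagonal hermitian form over `K` in every rank, from O'Meara 66:1 + 63:19
(cell pub-hodge-repro2, seat p3)

Tier-5 N2 support, rows N2.2.7 / N2.2.9 / N2.8.1 of route/T5-N2-route-3.md; towards Landherr's uniqueness in every
rank (file 172). File 168 represented `c₁` by the binary form `⟨c₁', c₂'⟩` through the quinary quadratic space; here
the same argument in every rank `n ≥ 2`, on the `(2n+1)`-ary space `⟨a, −aθ, −c⟩` over `K⁺` indexed by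
`ι ⊕ (ι ⊕ Unit)`:
* `isotropicDiag_comp_equiv`: `IsotropicDiag` is invariant under a reindexing of the coefficients (file 166's
  displays are stated on `Fin m`);
* **`exists_sum_mul_star_eq_of_OMeara`** — for `a : ι → K⁺` with non-zero entries, `#ι ≥ 2`, and `c ∈ K⁺^×` such
  that at every real embedding `ψ` some `ψ (a i)` has the sign of `ψ c`, there is `w : ι → K` with
  `∑ aᵢ wᵢ w̄ᵢ = c`: the space `⟨a, −aθ, −c⟩` is isotropic at every finite place (63:19, dimension `2n + 1 ≥ 5`)
  and at every real embedding (`ψ (a i)` and `−ψ c` have opposite signs), hence over `K⁺` (66:1); a global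
  isotropic vector `x` gives `∑ aᵢ N(zᵢ) = c x_∗²` with `zᵢ = x_{i,0} + x_{i,1} y`; divide by `x_∗`, or — `x_∗ = 0` —
  the hermitian form is isotropic hence universal (file 170).

Mathlib + this seat's files 146 / 161 / 166 / 168 / 170 and their imports; no new display; no device.
§8(d): uses an L-value-free non-vanishing device: NO.
-/

namespace Summit.Ventures.HodgeRepro2.T5GlobalRepresentation

open Matrix Finset NumberField NumberField.IsCMField IsDedekindDomain IsDedekindDomain.HeightOneSpectrum
open Summit.Ventures.HodgeRepro2.T5HasseMinkowskiDisplays Summit.Ventures.HodgeRepro2.T5HermitianDiagonalSign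
  Summit.Ventures.HodgeRepro2.T5ShimuraOfHasseMinkowski Summit.Ventures.HodgeRepro2.T5LandherrInvariants
  Summit.Ventures.HodgeRepro2.T5HermitianGlobalChain Summit.Ventures.HodgeRepro2.T5FinitePlaceCM

/-! ## Reindexing -/

section Reindex

variable {L : Type*} [Field L]

/-- `IsotropicDiag` is invariant under a reindexing of the coefficients. -/
theorem isotropicDiag_comp_equiv {ι κ : Type*} [Fintype ι] [Fintype κ] (e : κ ≃ ι) (a : ι → L) :
    IsotropicDiag L (a ∘ e) ↔ IsotropicDiag L a := by
  constructor
  · rintro ⟨x, hx0, hx⟩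
    refine ⟨x ∘ e.symm, ?_, ?_⟩
    · intro h
      apply hx0
      funext k
      have := congrFun h (e k)
      simpa using this
    · rw [← hx]
      exact (Fintype.sum_equiv e _ _ fun k => by simp).symm
  · rintro ⟨x, hx0, hx⟩
    refine ⟨x ∘ e, ?_, ?_⟩
    · intro h
      apply hx0
      funext i
      have := congrFun h (e.symm i)
      simpa using this
    · rw [← hx]
      exact Fintype.sum_equiv e _ _ fun k => by simp

end Reindex

/-! ## Representation over `K` from the two O'Meara displays -/

section Represent

variable {K : Type*} [Field K] [NumberField K] [IsCMField K]

/-- **Representation in every rank from O'Meara 66:1 + 63:19:** for `a : ι → K⁺` with non-zero entries, `#ι ≥ 2`,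
and `c ∈ K⁺^×` such that at every real embedding `ψ` of `K⁺` some `ψ (a i)` has the sign of `ψ c`, the diagonal
hermitian form `∑ aᵢ wᵢ w̄ᵢ` over `K` represents `c`. -/
theorem exists_sum_mul_star_eq_of_OMeara (hHM : OMeara1963_66_1 (maximalRealSubfield K))
    (h5 : OMeara1963_63_19 (maximalRealSubfield K)) {ι : Type*} [Fintype ι] [DecidableEq ι]
    {a : ι → maximalRealSubfield K} (ha0 : ∀ i, a i ≠ 0) (hcard : 2 ≤ Fintype.card ι)
    {c : maximalRealSubfield K} (hc0 : c ≠ 0)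
    (hreal : ∀ ψ : maximalRealSubfield K →+* ℝ, ∃ i, (0 < ψ (a i) ↔ 0 < ψ c)) :
    ∃ w : ι → K, ∑ i, algebraMap (maximalRealSubfield K) K (a i) * (w i * star (w i)) =
      algebraMap (maximalRealSubfield K) K c := by
  obtain ⟨θ, y, hθ, hy⟩ := exists_datum K
  have hθ0 : θ ≠ 0 := theta_ne_zero hθ hy
  -- the `(2n+1)`-ary quadratic space over `K⁺`, indexed by `ι ⊕ (ι ⊕ Unit)`
  set q : ι ⊕ (ι ⊕ Unit) → maximalRealSubfield K :=
    Sum.elim a (Sum.elim (fun i => -(a i * θ)) (fun _ => -c)) with hq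
  let e : Fin (Fintype.card (ι ⊕ (ι ⊕ Unit))) ≃ ι ⊕ (ι ⊕ Unit) := (Fintype.equivFin _).symm
  have hm : 5 ≤ Fintype.card (ι ⊕ (ι ⊕ Unit)) := by
    simp only [Fintype.card_sum, Fintype.card_unique]
    omega
  have hiso : IsotropicDiag (maximalRealSubfield K) (q ∘ e) := by
    refine hHM _ (q ∘ e) ?_ ?_ ?_
    · intro j
      simp only [Function.comp]
      rcases e j with i | i | u
      · simpa [q] using ha0 i
      · simpa [q] using mul_ne_zero (ha0 i) hθ0
      · simpa [q] using hc0
    · intro v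
      exact h5 v _ hm _
    · intro ψ
      obtain ⟨i, hi⟩ := hreal ψ
      have hψc : ψ c ≠ 0 := (map_ne_zero ψ).mpr hc0
      have hψa : ψ (a i) ≠ 0 := (map_ne_zero ψ).mpr (ha0 i)
      rcases lt_or_gt_of_ne hψc with hc | hc
      · -- `ψ c < 0`, so `ψ (a i) < 0`: the coefficient `−ψ c` is positive, `ψ (a i)` negative
        have hai : ψ (a i) < 0 := lt_of_le_of_ne (not_lt.mp fun h => absurd (hi.mp h) (not_lt.mpr hc.le)) hψa
        refine isotropicDiag_of_pos_of_neg (i := e.symm (Sum.inr (Sum.inr ()))) (j := e.symm (Sum.inl i)) ?_ ?_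
        · simp [q, hc]
        · simpa [q] using hai
      · -- `ψ c > 0`, so `ψ (a i) > 0`: `ψ (a i)` positive, `−ψ c` negative
        have hai : 0 < ψ (a i) := hi.mpr hc
        refine isotropicDiag_of_pos_of_neg (i := e.symm (Sum.inl i)) (j := e.symm (Sum.inr (Sum.inr ()))) ?_ ?_
        · simpa [q] using hai
        · simp [q, hc]
  rw [isotropicDiag_comp_equiv] at hiso
  obtain ⟨x, hx0, hx⟩ := hiso
  rw [Fintype.sum_sum_type, Fintype.sum_sum_type,
    Fintype.sum_unique fun u : Unit => q (Sum.inr (Sum.inr u)) * x (Sum.inr (Sum.inr u)) ^ 2] at hx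
  simp only [hq, Sum.elim_inl, Sum.elim_inr] at hx
  -- `zᵢ = x_{i,0} + x_{i,1} y` and `∑ aᵢ N(zᵢ) = c x_∗²`
  set z : ι → K := fun i => algebraMap (maximalRealSubfield K) K (x (Sum.inl i)) +
    algebraMap (maximalRealSubfield K) K (x (Sum.inr (Sum.inl i))) * y with hz
  have hN : ∀ i, z i * star (z i) =
      algebraMap (maximalRealSubfield K) K (x (Sum.inl i) ^ 2 - θ * x (Sum.inr (Sum.inl i)) ^ 2) :=
    fun i => mul_star_eq_sub hθ hy _ _
  have key : ∑ i, algebraMap (maximalRealSubfield K) K (a i) * (z i * star (z i)) =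
      algebraMap (maximalRealSubfield K) K (c * x (Sum.inr (Sum.inr ())) ^ 2) := by
    simp_rw [hN]
    simp_rw [← map_mul]
    rw [← map_sum]
    congr 1
    have hsplit : ∑ i, a i * (x (Sum.inl i) ^ 2 - θ * x (Sum.inr (Sum.inl i)) ^ 2) =
        ∑ i, a i * x (Sum.inl i) ^ 2 + ∑ i, -(a i * θ) * x (Sum.inr (Sum.inl i)) ^ 2 := by
      rw [← Finset.sum_add_distrib]
      refine Finset.sum_congr rfl fun i _ => ?_
      ring
    rw [hsplit]
    linear_combination hx
  by_cases h4 : x (Sum.inr (Sum.inr ())) = 0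
  · -- the hermitian form is isotropic
    rw [h4] at key
    simp only [ne_eq, OfNat.ofNat_ne_zero, not_false_eq_true, zero_pow, mul_zero, map_zero] at key
    have hz0 : z ≠ 0 := by
      intro hz0
      apply hx0
      funext j
      rcases j with i | i | u
      · exact (eq_zero_of_add_mul_eq_zero hy (congrFun hz0 i)).1
      · exact (eq_zero_of_add_mul_eq_zero hy (congrFun hz0 i)).2
      · exact h4
    haveI : NeZero (2 : K) := ⟨two_ne_zero⟩
    have hsa : ∀ i, star (algebraMap (maximalRealSubfield K) K (a i)) = algebraMap (maximalRealSubfield K) K (a i) :=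
      fun i => complexConj_apply_eq_self K (a i)
    have hA0 : ∀ i, algebraMap (maximalRealSubfield K) K (a i) ≠ 0 := fun i => (map_ne_zero _).mpr (ha0 i)
    have hsc : star (algebraMap (maximalRealSubfield K) K c) = algebraMap (maximalRealSubfield K) K c :=
      complexConj_apply_eq_self K c
    exact exists_sum_mul_star_eq_of_isotropic hsa hA0 hz0 key hsc
  · -- divide by `x_∗`
    set d : K := algebraMap (maximalRealSubfield K) K (x (Sum.inr (Sum.inr ()))) with hd
    have hd0 : d ≠ 0 := (map_ne_zero _).mpr h4
    have hsd : star d = d := complexConj_apply_eq_self K _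
    refine ⟨fun i => z i / d, ?_⟩
    have : ∀ i, algebraMap (maximalRealSubfield K) K (a i) * (z i / d * star (z i / d)) =
        algebraMap (maximalRealSubfield K) K (a i) * (z i * star (z i)) / (d * d) := by
      intro i
      rw [star_div₀, hsd]
      field_simp
    simp_rw [this]
    rw [← Finset.sum_div, key, hd, map_mul, map_pow, sq, mul_div_cancel_right₀ _ (mul_ne_zero hd0 hd0)]

end Represent

end Summit.Ventures.HodgeRepro2.T5GlobalRepresentation
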